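import Literature.Probability.RandomPlanarGeometry.SAWStripDeficit
import HarnessLib

/-!
# Pulled self-avoiding bridges pinned by a penetrable defect line (lane «pcv-sawmu», route R62 «PULLED-PINNING»)

Topic `Literature/Probability/RandomPlanarGeometry` (continues `SAWStripDeficit.lean` — the pulled strip partition
functions `StripDeficit.pulledStripZ`, `StripDeficit.StripDeficitUpper`, `StripDeficit.stripDeficit_two` — and the bridge
concatenation algebra of `SAWBridgeRenewalEquation.lean`, `concatWalk_mem_bridges`).

Objects (planner a-idea-1 `Sketch_G12` §R62, bodies verbatim): `colVisits N ω` = the number of times `k ∈ [1, N]` at which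
the walk sits on the column `x₁ = 0` (a PENETRABLE defect line parallel to the force `e₀`); `pinZ N y β = Σ_{ω ∈ B_N}
y^{span ω} e^{β·colVisits}`; `pinRetZ` = the sub-sum over bridges ending on the line.

This file: (S1) `pinRetZ_mul_le` — the returning class is supermultiplicative (concatenate; spans and column visits add);
(S2) `strip_to_pin` — «STRIP ⇒ PIN»: `y² e^{βN/(2W+1)} Z^{strip}_{N,W}(y) ≤ Z^{ret}_{N+3W+2}(y, β)` by the pigeonhole on the
`2W+1` columns and the hook surgery `e₀·(±e₁)^{|c|} · γ · e₀·(±e₁)^{|e|}·e₀^{pad}` realised as two bridge concatenations.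
[cite: MadrasSlade1993, §8.2 (bridges in strips); IoffeVelenik2008, §3 (pulled polymers)].

**Printed status / label of record** (lit-1 g7 cell (α), lead g8 r23, 2026-08-22): FIRST pinning theorem for the
self-avoiding walk itself (pulled, `d = 2`) at a PENETRABLE defect line: trivial threshold with an explicit QUADRATIC gain
`g ≥ β²/(96C + 24β)`, from the certified strip-confinement law R51 (`SAWStripDeficit`, p329996) by pigeonhole on strip
columns + hook surgery — not Ornstein–Zernike; printed analogues with the same `d = 2` quadratic shape: Friedli–Ioffe–Velenik
2013 Thm 1.1 (subcritical percolation with a line of defects) [cite: FriedliIoffeVelenik2013, Theorem 1.1], Ott–Velenik 2018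
(FK–Potts) [cite: OttVelenik2018, §1], Giacomin 2011 Thm 2.7/2.10 (effective (1+1) renewal pinning, α = ½)
[cite: Giacomin2011, Theorem 2.7 and Theorem 2.10]; the unforced penetrable adsorption point `β_c^P = 0` of SAW remains OPEN
[cite: Madras2017, p. 3] (Beaton 2014 arXiv:1408.6880 withdrawn).
Seat a-p1 gen 5, 2026-08-22.
-/

noncomputable section

open Finset Filter Topology
open scoped BigOperators
open Literature.Probability.LatticeModels

namespace Literature.Probability.RandomPlanarGeometry.SAW.Zd

open StripDeficit

/-! ### Objects (Sketch_G12 §R62, verbatim) -/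

open Classical in
/-- number of times `k ∈ [1, N]` at which the walk sits on the column `x₁ = 0` (the defect line, parallel to the force
`e₀`). [cite: IoffeVelenik2008, §3] -/
def colVisits (N : ℕ) (ω : ℕ → Site 2) : ℕ := ((range (N + 1)).filter fun k => 1 ≤ k ∧ ω k 1 = 0).card

open Classical in
/-- `Z^{pin}_N(y,β) = Σ_{ω ∈ B_N} y^{span ω} e^{β · colVisits}` — pulled bridges with a PENETRABLE defect line `x₁ = 0`.
[cite: IoffeVelenik2008, §3] -/
def pinZ (N : ℕ) (y β : ℝ) : ℝ :=
  ∑ ω ∈ bridges 2 N, y ^ (ω N 0).toNat * Real.exp (β * colVisits N ω)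

open Classical in
/-- the RETURNING sub-sum (endpoint back on the line): supermultiplicative, so its free energy is a `sup` (Fekete).
[cite: IoffeVelenik2008, §3] -/
def pinRetZ (N : ℕ) (y β : ℝ) : ℝ :=
  ∑ ω ∈ (bridges 2 N).filter (fun ω => ω N 1 = 0), y ^ (ω N 0).toNat * Real.exp (β * colVisits N ω)

/-! ### Column visits as a sum; additivity under concatenation -/

/-- `colVisits N ω = Σ_{k < N} [ω(k+1)₁ = 0]`. [folklore] -/
private theorem colVisits_eq_sum (N : ℕ) (ω : ℕ → Site 2) :
    colVisits N ω = ∑ k ∈ range N, if ω (k + 1) 1 = 0 then 1 else 0 := by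
  classical
  rw [colVisits, card_filter, sum_range_succ']
  simp

/-- Column visits add under concatenation of a returning walk with a walk from the origin.
[cite: MadrasSlade1993, §1.2 (concatenation of bridges)] -/
theorem colVisits_concatWalk {N M : ℕ} {η τ : ℕ → Site 2} (hηN : η N 1 = 0) (hτ0 : τ 0 = 0) :
    colVisits (N + M) (concatWalk N η τ) = colVisits N η + colVisits M τ := by
  rw [colVisits_eq_sum, colVisits_eq_sum, colVisits_eq_sum, sum_range_add]
  congr 1
  · refine sum_congr rfl fun k hk => ?_
    rw [mem_range] at hk
    rw [concatWalk_apply_of_le η τ (Nat.succ_le_of_lt hk)]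
  · refine sum_congr rfl fun k _ => ?_
    rw [show N + k + 1 = N + (k + 1) by ring, concatWalk_apply_add η τ hτ0, Pi.add_apply, hηN, zero_add]

/-- A sum over an injective image is dominated by the full sum of a nonnegative function. [folklore] -/
private theorem sum_le_sum_of_injOn' {ι κ : Type*} [DecidableEq κ] {s : Finset ι} {t : Finset κ}
    (e : ι → κ) (he : Set.InjOn e s) (hst : ∀ a ∈ s, e a ∈ t) (g : κ → ℝ)
    (hg : ∀ b ∈ t, 0 ≤ g b) : ∑ a ∈ s, g (e a) ≤ ∑ b ∈ t, g b := by
  rw [← Finset.sum_image (f := g) he]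
  exact sum_le_sum_of_subset_of_nonneg (image_subset_iff.2 hst) fun b hb _ => hg b hb

/-! ### (S1) Supermultiplicativity of the returning class -/

/-- The endpoint of a bridge has a nonnegative first coordinate. [cite: MadrasSlade1993, Definition 1.2.4] -/
private theorem bridge_end_nonneg {N : ℕ} {ω : ℕ → Site 2} (hω : ω ∈ bridges 2 N) : 0 ≤ ω N 0 := by
  obtain ⟨hs, hb⟩ := mem_bridges.1 hω
  have h0 : ω 0 = 0 := (mem_saws.1 hs).1
  rcases Nat.eq_zero_or_pos N with rfl | hN
  · rw [h0]; rfl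
  · have := (hb N hN le_rfl).1; rw [h0] at this; exact le_of_lt this

/-- **(S1) The returning class is supermultiplicative**: `Z^{ret}_N · Z^{ret}_M ≤ Z^{ret}_{N+M}` (`y ≥ 0`) — concatenate a
returning `N`-bridge and a returning `M`-bridge: the result is a returning `(N+M)`-bridge, spans and column visits add, and
the pieces are recovered from the lengths (planner `stub_R62_supermul`, verbatim).
[cite: MadrasSlade1993, §1.2, eq. (1.2.15) (b_n b_m ≤ b_{n+m})] -/
theorem pinRetZ_mul_le {y β : ℝ} (hy : 0 ≤ y) (N M : ℕ) :
    pinRetZ N y β * pinRetZ M y β ≤ pinRetZ (N + M) y β := by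
  classical
  set RN := (bridges 2 N).filter (fun ω => ω N 1 = 0) with hRN
  set RM := (bridges 2 M).filter (fun ω => ω M 1 = 0) with hRM
  set R := (bridges 2 (N + M)).filter (fun ω => ω (N + M) 1 = 0) with hR
  set w : ℕ → (ℕ → Site 2) → ℝ := fun n ω => y ^ (ω n 0).toNat * Real.exp (β * colVisits n ω) with hw
  have hwnn : ∀ n ω, 0 ≤ w n ω := fun n ω => by positivity
  -- the product as a sum over pairs
  have hprod : pinRetZ N y β * pinRetZ M y β = ∑ p ∈ RN ×ˢ RM, w N p.1 * w M p.2 := by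
    rw [pinRetZ, pinRetZ, sum_mul_sum, ← sum_product']
  rw [hprod]
  -- the concatenation map
  have hmaps : ∀ p ∈ RN ×ˢ RM, concatWalk N p.1 p.2 ∈ R := by
    rintro ⟨η, τ⟩ hp
    rw [mem_product, hRN, hRM, mem_filter, mem_filter] at hp
    obtain ⟨⟨hη, hηN⟩, hτ, hτM⟩ := hp
    simp only at hη hηN hτ hτM
    rw [hR, mem_filter]
    refine ⟨concatWalk_mem_bridges (Nat.le_add_right N M) hη (by rwa [Nat.add_sub_cancel_left]), ?_⟩
    have hτ0 : τ 0 = 0 := (mem_saws.1 (mem_bridges.1 hτ).1).1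
    rw [concatWalk_apply_add η τ hτ0, Pi.add_apply, hηN, hτM, add_zero]
  have hinj : Set.InjOn (fun p : (ℕ → Site 2) × (ℕ → Site 2) => concatWalk N p.1 p.2) ↑(RN ×ˢ RM) := by
    rintro ⟨η, τ⟩ hp ⟨η', τ'⟩ hp' h
    simp only [coe_product, Set.mem_prod, mem_coe, hRN, hRM, mem_filter] at hp hp'
    obtain ⟨h1, h2⟩ := concatWalk_injective_pieces (mem_bridges.1 hp.1.1).1 (mem_bridges.1 hp.2.1).1
      (mem_bridges.1 hp'.1.1).1 (mem_bridges.1 hp'.2.1).1 h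
    rw [h1, h2]
  -- the weights multiply
  have hweight : ∀ p ∈ RN ×ˢ RM, w N p.1 * w M p.2 = w (N + M) (concatWalk N p.1 p.2) := by
    rintro ⟨η, τ⟩ hp
    rw [mem_product, hRN, hRM, mem_filter, mem_filter] at hp
    obtain ⟨⟨hη, hηN⟩, hτ, hτM⟩ := hp
    simp only at hη hηN hτ hτM
    have hτ0 : τ 0 = 0 := (mem_saws.1 (mem_bridges.1 hτ).1).1
    simp only [hw]
    rw [concatWalk_apply_add η τ hτ0, Pi.add_apply, colVisits_concatWalk hηN hτ0,
      Int.toNat_add (bridge_end_nonneg hη) (bridge_end_nonneg hτ), pow_add, Nat.cast_add, mul_add,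
      Real.exp_add]
    ring
  rw [sum_congr rfl hweight]
  exact sum_le_sum_of_injOn' (fun p : (ℕ → Site 2) × (ℕ → Site 2) => concatWalk N p.1 p.2) hinj hmaps
    (w (N + M)) fun b _ => hwnn _ b

/-! ### (S2) The hook walks `e₀ · (a e₁)^m · e₀^p` -/

/-- The hook walk: one step `e₀`, then `m` transversal steps `a·e₁` (`a = ±1`), then `p` steps `e₀`; frozen afterwards.
[cite: MadrasSlade1993, §8.2] -/
def pinHook (a : ℤ) (m p : ℕ) (k : ℕ) : Site 2 :=
  if k = 0 then 0 else if k ≤ m + 1 then ![1, a * ((k : ℤ) - 1)]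
    else ![((min k (m + 1 + p) : ℕ) : ℤ) - m, a * m]

/-- The hook walk starts at the origin. [folklore] -/
private theorem pinHook_zero (a : ℤ) (m p : ℕ) : pinHook a m p 0 = 0 := by simp [pinHook]

/-- The transversal leg. [folklore] -/
private theorem pinHook_leg {a : ℤ} {m p k : ℕ} (hk1 : 1 ≤ k) (hk : k ≤ m + 1) :
    pinHook a m p k = ![1, a * ((k : ℤ) - 1)] := by
  rw [pinHook, if_neg (by omega), if_pos hk]

/-- The final vertical leg. [folklore] -/
private theorem pinHook_tail {a : ℤ} {m p k : ℕ} (hk : m + 1 < k) (hk' : k ≤ m + 1 + p) :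
    pinHook a m p k = ![(k : ℤ) - m, a * m] := by
  rw [pinHook, if_neg (by omega), if_neg (by omega), min_eq_left hk']

/-- Frozen at the endpoint `(p+1, a m)`. [folklore] -/
private theorem pinHook_end {a : ℤ} {m p k : ℕ} (hk : m + 1 + p ≤ k) :
    pinHook a m p k = ![(p : ℤ) + 1, a * m] := by
  rw [pinHook, if_neg (by omega)]
  by_cases h : k ≤ m + 1
  · rw [if_pos h]
    have hp : p = 0 := by omega
    have hk' : k = m + 1 := by omega
    subst hp; subst hk'
    simp
  · rw [if_neg h, min_eq_right hk]
    congr 1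
    push_cast
    ring

/-- Adjacency on `ℤ²` from coordinates. [folklore] -/
private theorem adj_of_coords' {u v : Site 2}
    (h : (v 0 = u 0 ∧ (v 1 = u 1 + 1 ∨ v 1 + 1 = u 1)) ∨ (v 1 = u 1 ∧ (v 0 = u 0 + 1 ∨ v 0 + 1 = u 0))) :
    (zdGraph 2).Adj u v := by
  rw [zdGraph_adj_iff_sub]
  rcases h with ⟨h0, h1 | h1⟩ | ⟨h1, h0 | h0⟩
  · exact ⟨1, Or.inl (by funext j; fin_cases j <;> simp <;> omega)⟩
  · exact ⟨1, Or.inr (by funext j; fin_cases j <;> simp <;> omega)⟩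
  · exact ⟨0, Or.inl (by funext j; fin_cases j <;> simp <;> omega)⟩
  · exact ⟨0, Or.inr (by funext j; fin_cases j <;> simp <;> omega)⟩

/-- The coordinates of the hook walk, in the three regimes, as linear facts (for `omega`). [folklore] -/
private theorem pinHook_coords (a : ℤ) (m p k : ℕ) :
    (k = 0 ∧ pinHook a m p k 0 = 0 ∧ pinHook a m p k 1 = 0) ∨
    (1 ≤ k ∧ k ≤ m + 1 ∧ pinHook a m p k 0 = 1 ∧ pinHook a m p k 1 = a * ((k : ℤ) - 1)) ∨
    (m + 1 < k ∧ k ≤ m + 1 + p ∧ pinHook a m p k 0 = (k : ℤ) - m ∧ pinHook a m p k 1 = a * m) ∨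
    (m + 1 + p < k ∧ pinHook a m p k 0 = (p : ℤ) + 1 ∧ pinHook a m p k 1 = a * m) := by
  rcases Nat.eq_zero_or_pos k with rfl | hk
  · left; simp [pinHook_zero]
  · by_cases h1 : k ≤ m + 1
    · right; left; refine ⟨hk, h1, ?_, ?_⟩ <;> simp [pinHook_leg hk h1]
    · by_cases h2 : k ≤ m + 1 + p
      · right; right; left; refine ⟨by omega, h2, ?_, ?_⟩ <;> simp [pinHook_tail (by omega) h2]
      · right; right; right; refine ⟨by omega, ?_, ?_⟩ <;> simp [pinHook_end (by omega : m + 1 + p ≤ k)]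

/-- **The hook walk is a bridge** of length `m + 1 + p`. [cite: MadrasSlade1993, Definition 1.2.4] -/
theorem pinHook_mem_bridges {a : ℤ} (ha : a = 1 ∨ a = -1) (m p : ℕ) :
    pinHook a m p ∈ bridges 2 (m + 1 + p) := by
  have vec_eq : ∀ u v : Site 2, u = v ↔ u 0 = v 0 ∧ u 1 = v 1 := fun u v =>
    ⟨fun h => by rw [h]; exact ⟨rfl, rfl⟩, fun h => by funext j; fin_cases j; exacts [h.1, h.2]⟩
  refine mem_bridges.2 ⟨mem_saws.2 ⟨pinHook_zero a m p, fun k hk => ?_, fun k hk => ?_, ?_⟩, fun k hk1 hk2 => ?_⟩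
  · rw [pinHook_end hk, pinHook_end le_rfl]
  · -- adjacency
    refine adj_of_coords' ?_
    have h1 := pinHook_coords a m p k
    have h2 := pinHook_coords a m p (k + 1)
    rcases ha with rfl | rfl
    · simp only [one_mul, Nat.cast_add, Nat.cast_one] at h1 h2
      omega
    · simp only [neg_one_mul, Nat.cast_add, Nat.cast_one, neg_sub] at h1 h2
      omega
  · -- injectivity
    intro i hi j hj hij
    simp only [Set.mem_setOf_eq] at hi hj
    rw [vec_eq] at hij
    have h1 := pinHook_coords a m p i
    have h2 := pinHook_coords a m p j
    rcases ha with rfl | rfl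
    · simp only [one_mul] at h1 h2
      omega
    · simp only [neg_one_mul, neg_sub] at h1 h2
      omega
  · -- bridge
    rw [pinHook_zero, pinHook_end le_rfl]
    have h1 := pinHook_coords a m p k
    simp only [Pi.zero_apply, Matrix.cons_val_zero]
    rcases ha with rfl | rfl
    · simp only [one_mul] at h1
      omega
    · simp only [neg_one_mul, neg_sub] at h1
      omega

/-- The endpoint of the hook walk. [cite: MadrasSlade1993, §8.2 (bridges in a strip)] -/
theorem pinHook_apply_length (a : ℤ) (m p : ℕ) : pinHook a m p (m + 1 + p) = ![(p : ℤ) + 1, a * m] :=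
  pinHook_end le_rfl

/-! ### (S2) The surgery `e₀ (±e₁)^{|c|} · γ · e₀ (±e₁)^{|e|} e₀^{pad}` -/

/-- The sign used for the transversal legs (`sgn 0 = 1`). [cite: MadrasSlade1993, §8.2 (bridges in a strip)] -/
def sgn' (z : ℤ) : ℤ := if z < 0 then -1 else 1

/-- `sgn' z = ±1`. [folklore] -/
private theorem sgn'_cases (z : ℤ) : sgn' z = 1 ∨ sgn' z = -1 := by
  unfold sgn'; split_ifs <;> simp

/-- `sgn' z · |z| = z`. [folklore] -/
private theorem sgn'_mul_abs (z : ℤ) : sgn' z * |z| = z := by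
  unfold sgn'
  split_ifs with h
  · rw [abs_of_neg h]; ring
  · rw [abs_of_nonneg (not_lt.1 h)]; ring

/-- `sgn' z · |z| = z`, `natAbs` form. [folklore] -/
private theorem sgn'_mul_natAbs (z : ℤ) : sgn' z * (z.natAbs : ℤ) = z := by
  rw [Int.natCast_natAbs]; exact sgn'_mul_abs z

/-- The surgery of route R62 (S2): translate the strip bridge `γ` so that the column `c` sits on the defect line, joining
the origin to the translated start by the hook `e₀ (∓e₁)^{|c|}` and the translated end back to the line by the hook
`e₀ (±e₁)^{|e|} e₀^{pad}`, `e = c − γ(N)₁`, padded to the fixed length `N + 3W + 2`. [cite: MadrasSlade1993, §8.2] -/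
def pinSurgery (W N : ℕ) (c : ℤ) (γ : ℕ → Site 2) : ℕ → Site 2 :=
  concatWalk (c.natAbs + 1 + N)
    (concatWalk (c.natAbs + 1) (pinHook (sgn' (-c)) c.natAbs 0) γ)
    (pinHook (sgn' (c - γ N 1)) (c - γ N 1).natAbs (3 * W - c.natAbs - (c - γ N 1).natAbs))

/-- Membership in `stripBridges`. [cite: MadrasSlade1993, §8.2] -/
theorem mem_stripBridges {T N : ℕ} {ω : ℕ → Site 2} :
    ω ∈ stripBridges T N ↔ ω ∈ bridges 2 N ∧ ∀ i ≤ N, |ω i 1| ≤ (T : ℤ) := by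
  classical
  rw [stripBridges, mem_filter]

section Surgery

variable {W N : ℕ} {c : ℤ} {γ : ℕ → Site 2}

/-- The first hook is a bridge of length `|c| + 1` ending at `(1, -c)`. [folklore] -/
private theorem hook₁_mem (c : ℤ) : pinHook (sgn' (-c)) c.natAbs 0 ∈ bridges 2 (c.natAbs + 1) := by
  simpa using pinHook_mem_bridges (sgn'_cases (-c)) c.natAbs 0

/-- The first hook ends at `(1, -c)`. [folklore] -/
private theorem hook₁_end (c : ℤ) : pinHook (sgn' (-c)) c.natAbs 0 (c.natAbs + 1) = ![1, -c] := by
  have := pinHook_apply_length (sgn' (-c)) c.natAbs 0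
  rw [Nat.add_zero] at this
  rw [this]
  have h : sgn' (-c) * |c| = -c := by
    have := sgn'_mul_abs (-c); rwa [abs_neg] at this
  funext i
  fin_cases i
  · simp
  · simp [h]

/-- The translated bridge: a bridge of length `|c| + 1 + N` whose value at time `|c| + 1 + j` is `(1, -c) + γ j`.
[cite: MadrasSlade1993, §1.2 (concatenation)] -/
private theorem inner_mem (hγ : γ ∈ bridges 2 N) :
    concatWalk (c.natAbs + 1) (pinHook (sgn' (-c)) c.natAbs 0) γ ∈ bridges 2 (c.natAbs + 1 + N) :=
  concatWalk_mem_bridges (Nat.le_add_right _ _) (hook₁_mem c) (by rwa [Nat.add_sub_cancel_left])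

/-- Values of the translated bridge. [folklore] -/
private theorem inner_apply_add (hγ0 : γ 0 = 0) (j : ℕ) :
    concatWalk (c.natAbs + 1) (pinHook (sgn' (-c)) c.natAbs 0) γ (c.natAbs + 1 + j) = ![1, -c] + γ j := by
  rw [concatWalk_apply_add _ _ hγ0, hook₁_end]

/-- Values on the first hook. [folklore] -/
private theorem inner_apply_le {k : ℕ} (hk : k ≤ c.natAbs + 1) :
    concatWalk (c.natAbs + 1) (pinHook (sgn' (-c)) c.natAbs 0) γ k = pinHook (sgn' (-c)) c.natAbs 0 k :=
  concatWalk_apply_of_le _ _ hk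

/-- The bookkeeping of lengths: `|c| + |e| ≤ 3W` for `γ` in the strip and `|c| ≤ W`. [folklore] -/
private theorem natAbs_le_of_strip (hγ : γ ∈ stripBridges W N) (hc : c.natAbs ≤ W) :
    c.natAbs + (c - γ N 1).natAbs ≤ 3 * W := by
  have h := (mem_stripBridges.1 hγ).2 N le_rfl
  have h1 : (c - γ N 1).natAbs ≤ c.natAbs + (γ N 1).natAbs := Int.natAbs_sub_le c (γ N 1)
  have h2 : ((γ N 1).natAbs : ℤ) ≤ W := by rw [Int.natCast_natAbs]; exact h
  have h3 : (γ N 1).natAbs ≤ W := by exact_mod_cast h2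
  omega

/-- **The surgery lands in the returning bridges of length `N + 3W + 2`.** [cite: MadrasSlade1993, §8.2] -/
theorem pinSurgery_mem (hγ : γ ∈ stripBridges W N) (hc : c.natAbs ≤ W) :
    pinSurgery W N c γ ∈ bridges 2 (N + 3 * W + 2) := by
  have hγb := (mem_stripBridges.1 hγ).1
  have hsum := natAbs_le_of_strip hγ hc
  rw [pinSurgery]
  refine concatWalk_mem_bridges (by omega) (inner_mem hγb) ?_
  have := pinHook_mem_bridges (sgn'_cases (c - γ N 1)) (c - γ N 1).natAbs
    (3 * W - c.natAbs - (c - γ N 1).natAbs)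
  convert this using 2
  omega

/-- The value of the surgery at the end: `(γ(N)₀ + pad + 2, 0)`. [cite: MadrasSlade1993, §8.2] -/
theorem pinSurgery_apply_length (hγ : γ ∈ stripBridges W N) (hc : c.natAbs ≤ W) :
    pinSurgery W N c γ (N + 3 * W + 2) =
      ![1 + γ N 0 + ((3 * W - c.natAbs - (c - γ N 1).natAbs : ℕ) + 1), 0] := by
  have hγb := (mem_stripBridges.1 hγ).1
  have hγ0 : γ 0 = 0 := (mem_saws.1 (mem_bridges.1 hγb).1).1
  have hsum := natAbs_le_of_strip hγ hc
  have hlen : N + 3 * W + 2 = (c.natAbs + 1 + N) +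
      ((c - γ N 1).natAbs + 1 + (3 * W - c.natAbs - (c - γ N 1).natAbs)) := by omega
  rw [pinSurgery, hlen, concatWalk_apply_add _ _ (pinHook_zero _ _ _), inner_apply_add hγ0,
    pinHook_apply_length]
  have he : sgn' (c - γ N 1) * ((c - γ N 1).natAbs : ℤ) = c - γ N 1 := sgn'_mul_natAbs _
  funext i
  fin_cases i
  · simp only [Pi.add_apply, Fin.zero_eta, Matrix.cons_val_zero]
  · simp only [Pi.add_apply, Fin.mk_one, Matrix.cons_val_one, Matrix.cons_val_fin_one, he]
    ring

/-- Inside the translated copy: `(|c| + 1 + j) ↦ (1, -c) + γ j` for `j ≤ N`. [cite: MadrasSlade1993, §8.2 (bridges in a strip)] -/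
theorem pinSurgery_apply_inner (hγ0 : γ 0 = 0) {j : ℕ} (hj : j ≤ N) :
    pinSurgery W N c γ (c.natAbs + 1 + j) = ![1, -c] + γ j := by
  rw [pinSurgery, concatWalk_apply_of_le _ _ (by omega), inner_apply_add hγ0]

/-- On the first hook: first coordinate `1` for `1 ≤ k ≤ |c| + 1`. [cite: MadrasSlade1993, §8.2 (bridges in a strip)] -/
theorem pinSurgery_apply_hook_fst {k : ℕ} (hk1 : 1 ≤ k) (hk : k ≤ c.natAbs + 1) :
    pinSurgery W N c γ k 0 = 1 := by
  rw [pinSurgery, concatWalk_apply_of_le _ _ (by omega), inner_apply_le hk, pinHook_leg hk1 hk]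
  simp

/-- The value at time `|c| + 1`: `(1, -c)`. [cite: MadrasSlade1993, §8.2 (bridges in a strip)] -/
theorem pinSurgery_apply_hook_end : pinSurgery W N c γ (c.natAbs + 1) = ![1, -c] := by
  rw [pinSurgery, concatWalk_apply_of_le _ _ (by omega), inner_apply_le le_rfl, hook₁_end]

/-- The first coordinate at time `|c| + 2` is `2` (the first step of `γ`, or of the second hook if `N = 0`, is `e₀`).
[cite: MadrasSlade1993, §8.2 (bridges in a strip)] -/
theorem pinSurgery_apply_succ_fst (hγ : γ ∈ stripBridges W N) (hc : c.natAbs ≤ W) :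
    pinSurgery W N c γ (c.natAbs + 2) 0 = 2 := by
  have hγb := (mem_stripBridges.1 hγ).1
  obtain ⟨hγs, hbr⟩ := mem_bridges.1 hγb
  have hγ0 : γ 0 = 0 := (mem_saws.1 hγs).1
  rcases Nat.eq_zero_or_pos N with hN | hN
  · -- `N = 0`: the second hook starts with `e₀`
    subst hN
    have hsum := natAbs_le_of_strip hγ hc
    rw [pinSurgery, show c.natAbs + 2 = (c.natAbs + 1 + 0) + 1 by omega,
      concatWalk_apply_add _ _ (pinHook_zero _ _ _), inner_apply_add hγ0, hγ0,
      pinHook_leg le_rfl (by omega)]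
    simp
  · -- `N ≥ 1`: the first step of the bridge `γ` is `e₀`
    rw [show c.natAbs + 2 = c.natAbs + 1 + 1 by omega, pinSurgery_apply_inner hγ0 hN]
    have h1 := (hbr 1 le_rfl hN).1
    have h2 := abs_sub_le_one_of_adj ((mem_saws.1 hγs).2.2.1 0 hN) 0
    rw [hγ0] at h1 h2
    simp only [Pi.zero_apply, sub_zero, zero_add] at h1 h2
    have : γ 1 0 = 1 := by rw [abs_le] at h2; omega
    simp [this]

end Surgery

/-! ### (S2) Column visits, the pigeonhole, and the injection -/

section StripToPin

variable {W N : ℕ} {c : ℤ} {γ : ℕ → Site 2}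

open Classical in
/-- The number of times `k ∈ [1, N]` at which `γ` sits on the column `x₁ = c`. [cite: IoffeVelenik2008, §3] -/
def colVisitsAt (N : ℕ) (γ : ℕ → Site 2) (c : ℤ) : ℕ := ((range N).filter fun j => γ (j + 1) 1 = c).card

/-- The surgery turns visits of `γ` to the column `c` into visits of the defect line. [cite: MadrasSlade1993, §8.2] -/
theorem colVisitsAt_le_colVisits_pinSurgery (hγ : γ ∈ stripBridges W N) (hc : c.natAbs ≤ W) :
    colVisitsAt N γ c ≤ colVisits (N + 3 * W + 2) (pinSurgery W N c γ) := by
  classical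
  have hγ0 : γ 0 = 0 := (mem_saws.1 (mem_bridges.1 (mem_stripBridges.1 hγ).1).1).1
  rw [colVisits_eq_sum, colVisitsAt, card_filter]
  set f : ℕ → ℕ := fun k => if pinSurgery W N c γ (k + 1) 1 = 0 then 1 else 0 with hf
  have hinj : Function.Injective fun j : ℕ => c.natAbs + 1 + j := fun a b h => by simpa using h
  have hreidx : ∑ j ∈ range N, (if γ (j + 1) 1 = c then 1 else 0) =
      ∑ k ∈ (range N).image (fun j => c.natAbs + 1 + j), f k := by
    rw [sum_image fun a _ b _ h => hinj h]
    refine sum_congr rfl fun j hj => ?_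
    rw [mem_range] at hj
    simp only [hf]
    rw [show c.natAbs + 1 + j + 1 = c.natAbs + 1 + (j + 1) by ring,
      pinSurgery_apply_inner (W := W) hγ0 (Nat.succ_le_of_lt hj)]
    have : (![1, -c] + γ (j + 1)) 1 = 0 ↔ γ (j + 1) 1 = c := by
      simp only [Pi.add_apply, Matrix.cons_val_one, Matrix.cons_val_fin_one]
      constructor <;> intro h <;> linarith
    by_cases h : γ (j + 1) 1 = c
    · rw [if_pos h, if_pos (this.2 h)]
    · rw [if_neg h, if_neg (fun h' => h (this.1 h'))]
  rw [hreidx]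
  refine sum_le_sum_of_subset_of_nonneg ?_ fun k _ _ => by positivity
  intro k hk
  obtain ⟨j, hj, rfl⟩ := mem_image.1 hk
  rw [mem_range] at hj ⊢
  omega

/-- **Pigeonhole**: a strip-`W` bridge visits one of the `2W+1` columns at least `N/(2W+1)` times among `k ∈ [1, N]`.
[cite: MadrasSlade1993, §8.2 (bridges in a strip)] -/
theorem exists_heavy_column (hγ : γ ∈ stripBridges W N) :
    ∃ c : ℤ, c.natAbs ≤ W ∧ N ≤ (2 * W + 1) * colVisitsAt N γ c := by
  classical
  obtain ⟨-, hstrip⟩ := mem_stripBridges.1 hγ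
  set cols : Finset ℤ := Icc (-(W : ℤ)) W with hcols
  have hmaps : ∀ j ∈ range N, γ (j + 1) 1 ∈ cols := fun j hj => by
    rw [mem_range] at hj
    rw [hcols, mem_Icc]
    exact abs_le.1 (hstrip (j + 1) (by omega))
  have hcard : cols.card = 2 * W + 1 := by
    rw [hcols, Int.card_Icc]
    have : (W : ℤ) + 1 - -(W : ℤ) = ((2 * W + 1 : ℕ) : ℤ) := by push_cast; ring
    rw [this, Int.toNat_natCast]
  have hsum : N = ∑ d ∈ cols, colVisitsAt N γ d := by
    have h := card_eq_sum_card_fiberwise hmaps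
    rw [card_range] at h
    refine h.trans (sum_congr rfl fun d _ => ?_)
    unfold colVisitsAt
    convert rfl
  have hne : cols.Nonempty := ⟨0, by rw [hcols, mem_Icc]; omega⟩
  obtain ⟨d, hd, hle⟩ : ∃ d ∈ cols, N ≤ cols.card * colVisitsAt N γ d := by
    refine exists_le_of_sum_le hne ?_
    rw [sum_const, smul_eq_mul, ← mul_sum, ← hsum]
  rw [hcard] at hle
  refine ⟨d, ?_, hle⟩
  rw [hcols, mem_Icc] at hd
  have : ((d.natAbs : ℕ) : ℤ) ≤ W := by rw [Int.natCast_natAbs]; exact abs_le.2 hd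
  exact_mod_cast this

open Classical in
/-- A heaviest admissible column of `γ` (junk value `0` off the strip bridges). [cite: MadrasSlade1993, §8.2 (bridges in a strip)] -/
def heavyCol (W N : ℕ) (γ : ℕ → Site 2) : ℤ :=
  if h : γ ∈ stripBridges W N then Classical.choose (exists_heavy_column h) else 0

/-- The defining property of the heaviest column. [cite: MadrasSlade1993, §8.2 (bridges in a strip)] -/
theorem heavyCol_spec (hγ : γ ∈ stripBridges W N) :
    (heavyCol W N γ).natAbs ≤ W ∧ N ≤ (2 * W + 1) * colVisitsAt N γ (heavyCol W N γ) := by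
  rw [heavyCol, dif_pos hγ]
  exact Classical.choose_spec (exists_heavy_column hγ)

/-- The map `γ ↦` its surgery at the heaviest column. [cite: MadrasSlade1993, §8.2] -/
def pinMap (W N : ℕ) (γ : ℕ → Site 2) : ℕ → Site 2 := pinSurgery W N (heavyCol W N γ) γ

/-- Decoding the column modulus: two surgeries with `|c| < |c'|` differ at time `|c| + 2` (first coordinate `2` vs `1`).
[folklore] -/
private theorem natAbs_not_lt_of_eq {γ γ' : ℕ → Site 2} {c c' : ℤ} (hγ : γ ∈ stripBridges W N)
    (hc : c.natAbs ≤ W) (h : pinSurgery W N c γ = pinSurgery W N c' γ') : ¬ c.natAbs < c'.natAbs := by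
  intro hlt
  have h2 := pinSurgery_apply_succ_fst hγ hc
  have h1 := pinSurgery_apply_hook_fst (W := W) (N := N) (γ := γ') (c := c') (k := c.natAbs + 2)
    (by omega) (by omega)
  rw [h, h1] at h2
  norm_num at h2

/-- **The surgery at the heaviest column is injective on the strip bridges** (read `|c|` off the first time the first
coordinate reaches `2`, then `c` off the vertex before, then `γ` by translation). [cite: MadrasSlade1993, §8.2] -/
theorem pinMap_injOn : Set.InjOn (pinMap W N) ↑(stripBridges W N) := by
  intro γ₁ h₁ γ₂ h₂ h
  rw [mem_coe] at h₁ h₂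
  simp only [pinMap] at h
  set c₁ := heavyCol W N γ₁ with hc₁def
  set c₂ := heavyCol W N γ₂ with hc₂def
  have hc₁ : c₁.natAbs ≤ W := (heavyCol_spec h₁).1
  have hc₂ : c₂.natAbs ≤ W := (heavyCol_spec h₂).1
  have hγ₁s := (mem_bridges.1 (mem_stripBridges.1 h₁).1).1
  have hγ₂s := (mem_bridges.1 (mem_stripBridges.1 h₂).1).1
  have hγ₁0 : γ₁ 0 = 0 := (mem_saws.1 hγ₁s).1
  have hγ₂0 : γ₂ 0 = 0 := (mem_saws.1 hγ₂s).1
  have habs : c₁.natAbs = c₂.natAbs := by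
    by_contra hne
    rcases Nat.lt_or_gt_of_ne hne with hlt | hlt
    · exact natAbs_not_lt_of_eq h₁ hc₁ h hlt
    · exact natAbs_not_lt_of_eq h₂ hc₂ h.symm hlt
  have hcc : c₁ = c₂ := by
    have e1 := pinSurgery_apply_hook_end (W := W) (N := N) (c := c₁) (γ := γ₁)
    have e2 := pinSurgery_apply_hook_end (W := W) (N := N) (c := c₂) (γ := γ₂)
    rw [h, habs, e2] at e1
    have := congrFun e1 1
    simp only [Matrix.cons_val_one, Matrix.cons_val_fin_one] at this
    linarith
  funext j
  have hN : γ₁ N = γ₂ N := by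
    have e1 := pinSurgery_apply_inner (W := W) (c := c₁) hγ₁0 (le_refl N)
    have e2 := pinSurgery_apply_inner (W := W) (c := c₂) hγ₂0 (le_refl N)
    rw [h, habs, hcc, e2] at e1
    exact (add_left_cancel e1).symm
  rcases le_or_gt j N with hj | hj
  · have e1 := pinSurgery_apply_inner (W := W) (c := c₁) hγ₁0 hj
    have e2 := pinSurgery_apply_inner (W := W) (c := c₂) hγ₂0 hj
    rw [h, habs, hcc, e2] at e1
    exact (add_left_cancel e1).symm
  · rw [(mem_saws.1 hγ₁s).2.1 j hj.le, (mem_saws.1 hγ₂s).2.1 j hj.le, hN]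

/-- **(S2) «STRIP ⇒ PIN»** (planner `stub_R62_strip_to_pin`, verbatim): every strip-`W` bridge of length `N` yields,
injectively, a RETURNING bridge of length `N + 3W + 2` whose heaviest column has been moved onto the defect line; hence
`y² e^{βN/(2W+1)} Z^{strip}_{N,W}(y) ≤ Z^{ret}_{N+3W+2}(y, β)` for `y ≥ 1`, `β ≥ 0`.
[cite: MadrasSlade1993, §8.2; IoffeVelenik2008, §3] -/
theorem strip_to_pin {y β : ℝ} (hy : 1 ≤ y) (hβ : 0 ≤ β) (W N : ℕ) (hW : 1 ≤ W) :
    y ^ 2 * Real.exp (β * N / (2 * W + 1)) * pulledStripZ W N y ≤ pinRetZ (N + 3 * W + 2) y β := by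
  classical
  have _hW := hW
  set n := N + 3 * W + 2 with hn
  set w : (ℕ → Site 2) → ℝ := fun ω => y ^ (ω n 0).toNat * Real.exp (β * colVisits n ω) with hw
  have hwnn : ∀ ω, 0 ≤ w ω := fun ω => by positivity
  rw [pulledStripZ, mul_sum, pinRetZ]
  -- termwise comparison with the surgery
  have hterm : ∀ γ ∈ stripBridges W N,
      y ^ 2 * Real.exp (β * N / (2 * W + 1)) * y ^ (γ N 0).toNat ≤ w (pinMap W N γ) := by
    intro γ hγ
    obtain ⟨hc, hvis⟩ := heavyCol_spec hγ
    have hγb := (mem_stripBridges.1 hγ).1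
    have hspan : 0 ≤ γ N 0 := bridge_end_nonneg hγb
    simp only [hw, pinMap]
    rw [hn, pinSurgery_apply_length hγ hc]
    simp only [Matrix.cons_val_zero]
    set pad := 3 * W - (heavyCol W N γ).natAbs - (heavyCol W N γ - γ N 1).natAbs with hpad
    have htoNat : (1 + γ N 0 + ((pad : ℤ) + 1)).toNat = (γ N 0).toNat + (pad + 2) := by
      have : 1 + γ N 0 + ((pad : ℤ) + 1) = (((γ N 0).toNat + (pad + 2) : ℕ) : ℤ) := by
        push_cast; rw [Int.toNat_of_nonneg hspan]; ring
      rw [this, Int.toNat_natCast]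
    rw [htoNat, pow_add]
    -- the pulling weight: `y^{pad+2} ≥ y²`
    have hy2 : y ^ 2 ≤ y ^ (pad + 2) := pow_le_pow_right₀ hy (by omega)
    -- the pinning weight: `N/(2W+1) ≤ colVisits`
    have hvisR : (N : ℝ) / (2 * W + 1) ≤ (colVisits (N + 3 * W + 2) (pinSurgery W N (heavyCol W N γ) γ) : ℝ) := by
      rw [div_le_iff₀ (by positivity)]
      have h1 := colVisitsAt_le_colVisits_pinSurgery hγ hc
      have h2 : (N : ℝ) ≤ (2 * W + 1) * (colVisitsAt N γ (heavyCol W N γ) : ℝ) := by exact_mod_cast hvis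
      have h3 : (colVisitsAt N γ (heavyCol W N γ) : ℝ) ≤ colVisits (N + 3 * W + 2) (pinSurgery W N (heavyCol W N γ) γ) := by
        exact_mod_cast h1
      nlinarith
    have hexp : Real.exp (β * N / (2 * W + 1)) ≤
        Real.exp (β * (colVisits (N + 3 * W + 2) (pinSurgery W N (heavyCol W N γ) γ) : ℝ)) := by
      apply Real.exp_le_exp.2
      rw [mul_div_assoc]
      exact mul_le_mul_of_nonneg_left hvisR hβ
    have hyN : 0 ≤ y ^ (γ N 0).toNat := by positivity
    calc y ^ 2 * Real.exp (β * N / (2 * W + 1)) * y ^ (γ N 0).toNat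
        = y ^ (γ N 0).toNat * y ^ 2 * Real.exp (β * N / (2 * W + 1)) := by ring
      _ ≤ y ^ (γ N 0).toNat * y ^ (pad + 2) *
          Real.exp (β * (colVisits (N + 3 * W + 2) (pinSurgery W N (heavyCol W N γ) γ) : ℝ)) :=
        mul_le_mul (mul_le_mul_of_nonneg_left hy2 hyN) hexp (by positivity) (by positivity)
  -- the surgery lands in the returning bridges
  have hmaps : ∀ γ ∈ stripBridges W N,
      pinMap W N γ ∈ (bridges 2 n).filter (fun ω => ω n 1 = 0) := by
    intro γ hγ
    obtain ⟨hc, -⟩ := heavyCol_spec hγ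
    rw [mem_filter]
    refine ⟨pinSurgery_mem hγ hc, ?_⟩
    simp only [pinMap]
    rw [hn, pinSurgery_apply_length hγ hc]
    simp
  refine (sum_le_sum hterm).trans ?_
  exact sum_le_sum_of_injOn' (pinMap W N) pinMap_injOn hmaps w fun ω _ => hwnn ω

end StripToPin

/-! ### (S3) From the strip deficit to an all-large-`N` pinning gain -/

section Gain

/-- The straight bridge runs along the defect line: `Z^{ret}_N(y, β) ≥ 1` for `y ≥ 1`, `β ≥ 0`.
[cite: MadrasSlade1993, §1.2] -/
theorem one_le_pinRetZ {y β : ℝ} (hy : 1 ≤ y) (hβ : 0 ≤ β) (N : ℕ) : 1 ≤ pinRetZ N y β := by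
  classical
  have hmem : straightWalk 2 N ∈ (bridges 2 N).filter (fun ω => ω N 1 = 0) := by
    rw [mem_filter]
    refine ⟨mem_bridges.2 ⟨straightWalk_mem_saws 2 N, fun i h1 h2 => ?_⟩, ?_⟩
    · simp only [straightWalk, Pi.single_eq_same, min_eq_left h2, min_self, Nat.zero_min, Nat.cast_zero]
      exact ⟨by exact_mod_cast h1, by exact_mod_cast h2⟩
    · simp [straightWalk]
  have hterm : (1 : ℝ) ≤
      y ^ ((straightWalk 2 N) N 0).toNat * Real.exp (β * colVisits N (straightWalk 2 N)) := by
    have h1 : (1 : ℝ) ≤ y ^ ((straightWalk 2 N) N 0).toNat := one_le_pow₀ hy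
    have h2 : (1 : ℝ) ≤ Real.exp (β * colVisits N (straightWalk 2 N)) := Real.one_le_exp (by positivity)
    nlinarith
  rw [pinRetZ]
  exact hterm.trans (single_le_sum (f := fun ω => y ^ (ω N 0).toNat * Real.exp (β * colVisits N ω))
    (fun ω _ => by positivity) hmem)

/-- Iterating (S1): `(Z^{ret}_{N'})^q ≤ Z^{ret}_{qN'}`. [cite: MadrasSlade1993, §1.2, eq. (1.2.15)] -/
theorem pinRetZ_pow_le {y β : ℝ} (hy : 1 ≤ y) (hβ : 0 ≤ β) (N' : ℕ) :
    ∀ q : ℕ, pinRetZ N' y β ^ q ≤ pinRetZ (q * N') y β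
  | 0 => by simpa using one_le_pinRetZ hy hβ 0
  | q + 1 => by
      rw [pow_succ, show (q + 1) * N' = q * N' + N' by ring]
      have h0 : 0 ≤ pinRetZ N' y β := by linarith [one_le_pinRetZ hy hβ N']
      exact (mul_le_mul_of_nonneg_right (pinRetZ_pow_le hy hβ N' q) h0).trans
        (pinRetZ_mul_le (by linarith) _ _)

/-- **(S3) The gain lemma** (planner `stub_R62_gain_of_stripDeficitUpper`, verbatim): under the upper strip-deficit law
`StripDeficitUpper y C T₀`, for every admissible width `W` (`W ≥ T₀`, `W ≥ 1`, `βW ≥ 4C`) the pinned free energy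
exceeds `λ_B(y)` by at least `β/(24W)`, for all large `N`. Proof: one good block length `N' = N + 3W + 2` from the
frequently-in-`N` deficit law and (S2), then blocks by (S1) (no limit needed). [cite: MadrasSlade1993, §8.2, Theorem 8.2.1; IoffeVelenik2008, §3] -/
theorem gain_of_stripDeficitUpper {y C β : ℝ} {T₀ W : ℕ} (hU : StripDeficitUpper y C T₀) (hy : 1 ≤ y)
    (hβ : 0 < β) (hW₀ : T₀ ≤ W) (hW1 : 1 ≤ W) (hCW : 4 * C ≤ β * W) :
    ∃ N₀ : ℕ, ∀ N : ℕ, N₀ ≤ N →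
      Real.exp ((N : ℝ) * (pulledBridgeFreeEnergy 2 y + β / (24 * W))) ≤ pinRetZ N y β := by
  set lam := pulledBridgeFreeEnergy 2 y with hlam
  have hW : (1 : ℝ) ≤ W := by exact_mod_cast hW1
  have hW0 : (0 : ℝ) < W := by linarith
  set u : ℝ := β / (48 * W) with hu
  have hu0 : 0 < u := by positivity
  -- the target rate and the slack
  set r : ℝ := lam + β / (24 * W) + β / (96 * W) with hr
  -- choose `M` with `(3W+2)·r ≤ M·u`
  obtain ⟨M, hM⟩ : ∃ M : ℕ, ((3 * W + 2 : ℕ) : ℝ) * r ≤ M * u := by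
    obtain ⟨M, hM⟩ := exists_nat_ge (((3 * W + 2 : ℕ) : ℝ) * r / u)
    exact ⟨M, (div_le_iff₀ hu0).1 hM⟩
  -- a good `N ≥ M` from the frequently-in-`N` deficit law at width `W`, `ε = β/(96W)`
  have hfreq := hU W hW₀ (β / (96 * W)) (by positivity)
  obtain ⟨N, hNM, hN⟩ := Filter.frequently_atTop.1 hfreq M
  -- the good block
  have hblock : Real.exp (((N + 3 * W + 2 : ℕ) : ℝ) * r) ≤ pinRetZ (N + 3 * W + 2) y β := by
    have h2 := strip_to_pin hy hβ.le W N hW1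
    -- the rate bookkeeping
    have h1 : β / (3 * W) ≤ β / (2 * W + 1) :=
      div_le_div_of_nonneg_left hβ.le (by positivity) (by linarith)
    have h3 : C / (W : ℝ) ^ 2 ≤ β / (4 * W) := by
      rw [div_le_div_iff₀ (by positivity) (by positivity)]
      nlinarith
    have hcoef : u ≤ β / (2 * W + 1) - C / (W : ℝ) ^ 2 - β / (96 * W) - (β / (24 * W) + β / (96 * W)) := by
      have : β / (3 * W) - β / (4 * W) - β / (96 * W) - (β / (24 * W) + β / (96 * W)) = u := by
        rw [hu]; field_simp; ring
      linarith
    have hN0 : (0 : ℝ) ≤ N := Nat.cast_nonneg N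
    have hNM' : (M : ℝ) * u ≤ N * u := mul_le_mul_of_nonneg_right (by exact_mod_cast hNM) hu0.le
    have hmul := mul_le_mul_of_nonneg_left hcoef hN0
    have key : ((N + 3 * W + 2 : ℕ) : ℝ) * r ≤ β * N / (2 * W + 1) + N * (lam - C / (W : ℝ) ^ 2 - β / (96 * W)) := by
      have e : (N : ℝ) * r + N * (β / (2 * W + 1) - C / (W : ℝ) ^ 2 - β / (96 * W) - (β / (24 * W) + β / (96 * W))) =
          β * N / (2 * W + 1) + N * (lam - C / (W : ℝ) ^ 2 - β / (96 * W)) := by rw [hr]; ring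
      push_cast at hM ⊢
      nlinarith
    have hZ0 : 0 ≤ pulledStripZ W N y := le_trans (Real.exp_pos _).le hN
    calc Real.exp (((N + 3 * W + 2 : ℕ) : ℝ) * r)
        ≤ Real.exp (β * N / (2 * W + 1) + N * (lam - C / (W : ℝ) ^ 2 - β / (96 * W))) := Real.exp_le_exp.2 key
      _ = Real.exp (β * N / (2 * W + 1)) * Real.exp (N * (lam - C / (W : ℝ) ^ 2 - β / (96 * W))) :=
          Real.exp_add _ _
      _ ≤ y ^ 2 * Real.exp (β * N / (2 * W + 1)) * pulledStripZ W N y := by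
          have hy2 : (1 : ℝ) ≤ y ^ 2 := one_le_pow₀ hy
          have hE : 0 ≤ Real.exp (β * N / (2 * W + 1)) := (Real.exp_pos _).le
          calc Real.exp (β * N / (2 * W + 1)) * Real.exp (N * (lam - C / (W : ℝ) ^ 2 - β / (96 * W)))
              ≤ Real.exp (β * N / (2 * W + 1)) * pulledStripZ W N y := mul_le_mul_of_nonneg_left hN hE
            _ = 1 * (Real.exp (β * N / (2 * W + 1)) * pulledStripZ W N y) := by ring
            _ ≤ y ^ 2 * (Real.exp (β * N / (2 * W + 1)) * pulledStripZ W N y) :=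
                mul_le_mul_of_nonneg_right hy2 (mul_nonneg hE hZ0)
            _ = y ^ 2 * Real.exp (β * N / (2 * W + 1)) * pulledStripZ W N y := by ring
      _ ≤ pinRetZ (N + 3 * W + 2) y β := h2
  -- blocks: for all large `n`
  set N' := N + 3 * W + 2 with hN'
  have hN'pos : 0 < N' := by omega
  obtain ⟨N₀, hN₀⟩ := exists_nat_ge ((N' : ℝ) * max r 0 / (β / (96 * W)))
  refine ⟨N₀, fun n hn => ?_⟩
  have hg0 : 0 < β / (96 * W) := by positivity
  have hng : (N' : ℝ) * max r 0 ≤ n * (β / (96 * W)) := by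
    have := (div_le_iff₀ hg0).1 hN₀
    have hn' : (N₀ : ℝ) ≤ n := by exact_mod_cast hn
    nlinarith
  -- `n = q N' + s`
  have hsplit : n / N' * N' + n % N' = n := Nat.div_add_mod' n N'
  have hs : n % N' < N' := Nat.mod_lt _ hN'pos
  have hrate : (n : ℝ) * (lam + β / (24 * W)) ≤ ((n / N' * N' : ℕ) : ℝ) * r := by
    have hq : ((n / N' * N' : ℕ) : ℝ) = n - (n % N' : ℕ) := by
      have : ((n / N' * N' : ℕ) : ℝ) + ((n % N' : ℕ) : ℝ) = n := by exact_mod_cast hsplit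
      linarith
    rw [hq]
    have hs' : ((n % N' : ℕ) : ℝ) ≤ N' := by exact_mod_cast hs.le
    have hs0 : (0 : ℝ) ≤ ((n % N' : ℕ) : ℝ) := Nat.cast_nonneg _
    have hmax : ((n % N' : ℕ) : ℝ) * r ≤ (N' : ℝ) * max r 0 := by
      calc ((n % N' : ℕ) : ℝ) * r ≤ ((n % N' : ℕ) : ℝ) * max r 0 :=
            mul_le_mul_of_nonneg_left (le_max_left _ _) hs0
        _ ≤ (N' : ℝ) * max r 0 := mul_le_mul_of_nonneg_right hs' (le_max_right _ _)
    rw [hr] at hmax ⊢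
    nlinarith
  calc Real.exp ((n : ℝ) * (pulledBridgeFreeEnergy 2 y + β / (24 * W)))
      ≤ Real.exp (((n / N' * N' : ℕ) : ℝ) * r) := Real.exp_le_exp.2 hrate
    _ = Real.exp ((N' : ℝ) * r) ^ (n / N') := by
        rw [← Real.exp_nat_mul]; push_cast; ring_nf
    _ ≤ pinRetZ N' y β ^ (n / N') := pow_le_pow_left₀ (Real.exp_pos _).le hblock _
    _ ≤ pinRetZ (n / N' * N') y β := pinRetZ_pow_le hy hβ.le N' _
    _ ≤ pinRetZ (n / N' * N') y β * pinRetZ (n % N') y β :=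
        le_mul_of_one_le_right (by linarith [one_le_pinRetZ hy hβ.le (n / N' * N')]) (one_le_pinRetZ hy hβ.le _)
    _ ≤ pinRetZ (n / N' * N' + n % N') y β := pinRetZ_mul_le (by linarith) _ _
    _ = pinRetZ n y β := by rw [hsplit]

end Gain

/-! ### The headline -/

/-- `Z^{ret} ≤ Z^{pin}` (a sub-sum of nonnegative terms). [folklore] -/
private theorem pinRetZ_le_pinZ (N : ℕ) (y β : ℝ) (hy : 0 ≤ y) : pinRetZ N y β ≤ pinZ N y β := by
  classical
  rw [pinRetZ, pinZ]
  exact sum_le_sum_of_subset_of_nonneg (filter_subset _ _) fun ω _ _ => by positivity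

/-- **R62 HEADLINE «PULLED-PINNING», conditional form** (planner composition `pulledPinning_two_of`, verbatim, with
(S3) supplied by `gain_of_stripDeficitUpper`): an upper strip-deficit law at `y = 2` gives, for EVERY `β > 0`, a
pinning gain `g > 0` — `exp(N(λ_B(2) + g)) ≤ Z^{pin}_N(2, β)` for all large `N`, with `g = β/(24W)`,
`W = max(T₀, 1, ⌈4C/β⌉)`, i.e. `g ≥ β²/(96C + 24β)` for small `β`. [cite: IoffeVelenik2008, §3; MadrasSlade1993, §8.2] -/
theorem pulledPinning_two_of (hdef : ∃ C : ℝ, ∃ T₀ : ℕ, StripDeficitUpper 2 C T₀) :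
    ∀ β : ℝ, 0 < β → ∃ g : ℝ, 0 < g ∧ ∃ N₀ : ℕ, ∀ N : ℕ, N₀ ≤ N →
      Real.exp ((N : ℝ) * (pulledBridgeFreeEnergy 2 2 + g)) ≤ pinZ N 2 β := by
  intro β hβ
  obtain ⟨C, T₀, hU⟩ := hdef
  obtain ⟨W, hW₀, hW1, hCW⟩ : ∃ W : ℕ, T₀ ≤ W ∧ 1 ≤ W ∧ 4 * C ≤ β * W := by
    obtain ⟨n, hn⟩ := exists_nat_ge (4 * C / β)
    refine ⟨max (max T₀ 1) n, le_trans (le_max_left _ _) (le_max_left _ _),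
      le_trans (le_max_right _ _) (le_max_left _ _), ?_⟩
    have h1 : 4 * C / β ≤ ((max (max T₀ 1) n : ℕ) : ℝ) := le_trans hn (by exact_mod_cast le_max_right _ _)
    have h2 := (div_le_iff₀ hβ).1 h1
    linarith [h2, mul_comm (((max (max T₀ 1) n : ℕ) : ℝ)) β]
  obtain ⟨N₀, hN⟩ := gain_of_stripDeficitUpper hU (by norm_num) hβ hW₀ hW1 hCW
  exact ⟨β / (24 * W), by positivity, N₀, fun N hNN => (hN N hNN).trans (pinRetZ_le_pinZ N 2 β (by norm_num))⟩

end Literature.Probability.RandomPlanarGeometry.SAW.Zd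

end
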